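import Summits.QuantumFields.YangMills.Theorems.BalabanUVNodesN18KingModelOneRunReadouts

/-!
# BalabanUVNodes ∕ N18 — KING'S `sup` OVER `x′ ∈ B^n(x)` AND (0.25) IN THE POLYMER REPRESENTATION: King's (4.42) graphs read at
# EVERY FINE POINT of both runs' lattices, smeared with block-ℓ¹-normalised configuration-dependent test weights, ARE sums over
# Bałaban's torus catalogue `𝐃_j` of localized activities carrying `NE5` AND the one-run envelopes `DecayBound` at ONE decay
# letter on the END's carriers `torusCarriers` ∕ `reFunctional` (Track A, DAG node N18 = NE5 `T4OutputRate.NE5 EA EB W κ θ C₅`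
# :211; director-ym R134 row n18 s3 «King-model transfer `N18KingModelTorus` (κ, C₅ from (d, L, a, m², γ)) →
# `TwoRunTorusNE5Final*`», module 5c of seat pub-ymgap-dag-n18-e; 5a = `N18KingModelOneRun`, 5b = `N18KingModelOneRunReadouts`)

HONEST FRAMING.  Count-neutral kernel bookkeeping (seat pub-ymgap-dag-n18-e g5, strategy s3; `--supports` K3′
`SpineGivenEndpointR12`, helper).  King's `A = 0` scalar MODEL ([King1986], printed and proved, typed by seats n18-a∕n18-b) —
NOT Bałaban's covariant one-step outputs `E^{(j)}(X; g, U_k(V))` of [Balaban1987RG1] (0.24)∕(2.13), for which NE5 is NOT IN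
PRINT and has no tree producer (NODE O instance 0∕1); NOT a node discharge; finite tori; nothing continuum ∕ ℝ⁴ ∕ OS ∕
mass-gap ∕ Clay.  THEOREMS ONLY: 0 `def`, 0 `sorry`, standard axioms.

THE POINT.  Module 4b (p470068 `N18KingModelPolymerRep.kingModel_polymerRep_ne5`) typed the polymer representation (0.24) of
King's model on the END's carriers with `NE5` located activities, reading each line of the torus at the BASE POINTS of its
two blocks («WHAT THIS DOES NOT DO.  Lines are pairs of BLOCKS read at the blocks' base points (fine-point multiplicity …
stay outside)»; referee dag-ref-F READ-64 on p465902, GAP-STATED «fine-point multiplicity»), and without the one-run envelope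
(0.25).  King's (3.73) is a statement at EVERY fine point: p. 664 «we denote by x that point in T_η for which x′ ∈ B^n(x)»,
(3.73) p. 665 bounds `sup_{x′,y′} |G^η(x, y) − G^{η′}(x′, y′)|`.  THIS FILE, **`kingModel_polymerRep_finePoints`** (d = 4,
ρ = 1∕4, END tori `N j = L·M_{j+1}`): `∃ κ > 0, A ≥ 0, C₅ ≥ 0` ((L, a, m², γ) and d = 4 only) such that for every `n ≥ 1`,
Bałaban volumes `L·M_k = 2L^{m_k}`, END data `W`, window `W′`, and every scale∕configuration-indexed family of TEST WEIGHTS ON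
RUN B's FINE PAIRS `w_j(φ)(x′, y′)`, `x′, y′ ∈ T_{η′}` (`L^nL^{j+1}` points per unit side), BLOCK-ℓ¹-NORMALISED —
`Σ_{x′ ∈ B(p), y′ ∈ B(q)} |w_j(φ)(x′, y′)| ≤ 1` for every pair of unit blocks `(p, q)` (e.g. block means of a field bounded by
one; the same insertion in both runs, NE5's «at fixed arguments») — there are CONFIGURATION-DEPENDENT ACTIVITIES
`K_A, K_B : (X : Σ j, 𝐃_j) → (W X.1).Φ → ℝ` with
(a) `NE5 (torusCarriers N W) (reFunctional … K_A) (reFunctional … K_B) W′ κ (L^{−γ∕2}) C₅` — N18's decl of record BY NAME on the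
carriers and read-out of `TwoRunTorusNE5Final8.ne5_end_final_all8`;
(d) `DecayBound (reFunctional … K_A) W′ A κ ∧ DecayBound (reFunctional … K_B) W′ A κ` — (0.25) AT THE SAME `κ` (the `hA1`∕`hB1`
one-run slots of the END's junction `TwoRunTorusNE5.ne5_of_torus_rates_all_scales` next to its two-run slot);
(b) RESUMMATION, (0.24) in the model at every fine point: `Σ_{X ∈ 𝐃_j} K_A⟨j, X⟩ φ = Σ_{(x′,y′)} w_j(φ)(x′,y′)·[ℋ_{j+1} C^{(j+1)} ℋ_{j+1}](x, y)`
with `x, y ∈ T_η` the points UNDER `x′, y′` (`⌊x′∕L^n⌋`, `N18KingModel.coarse_val`), and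
`Σ_{X ∈ 𝐃_j} K_B⟨j, X⟩ φ = Σ_{(x′,y′)} w_j(φ)(x′,y′)·[ℋ_{j+1+n} C^{(j+1+n)} ℋ_{j+1+n}](x′, y′)` — King's ACTUAL `A = 0` operators
(`ℋ = minimiser`, `C^{(·)} = (effLaplacian + aL⁻²·blockProj)⁻¹`);
(c) LOCALITY: `K_A⟨j, X⟩ φ`, `K_B⟨j, X⟩ φ` are the `w`-weighted sums of their run's graph over ONE AND THE SAME finite set of
FINE LINES whose blocks are cubes of `X` (those whose block pair's selected connecting polymer — `N18KingModelEndDecay.exists_live_domain`,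
`X ∋ B(x′), B(y′)`, `¼·d_j(X) ≤ |B(x′) − B(y′)|_{T₁}` — is `X`).
Exported letters: `κ∕8`, `A·(4·2^4)²·2!(8∕κ)²e^{κ∕8}`, `C₅·(4·2^4)²·2!(8∕κ)²e^{κ∕8}` of the per-line letters (proof chain in the
theorem's docstring).
WHAT THIS DOES NOT DO.  King's (2.20)-rescaling factor `(L^jη)^{2−d−γ}` is a normalisation of the test weights, not derived
here; vertex functions at `z, w` and the derivative ∕ Hölder rows of (3.73) outside; `A = 0`, `g`∕`U` unread; NOT Bałaban's
`E^{(j)}(X; g, U)`.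

Sources: C. King, Commun. Math. Phys. **102** (1986) 649–677 [King1986] — Prop. 3.9 (3.73) p. 665, p. 664 («x′ ∈ B^n(x)»),
(4.42)–(4.43) p. 675, Thm 3.3 p. 658; T. Bałaban, Commun. Math. Phys. **109** (1987) 249–301 [Balaban1987RG1] — (0.24)–(0.25)
p. 257, (1.18) p. 263, Thm 1 p. 259; **116** (1988) 1–22 [Balaban1988RG2Cluster] (2.30) p. 18; **102** (1985) 255–275
[Balaban1985UV3] p. 262 (*"The localizations {□_j} and the walks ω replacing lines of the graph define a localization X"*).
No claim about the mass gap.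
-/

noncomputable section

namespace Summit.QuantumFields.YangMills.BalabanUVNodes.N18KingModelFinePoints

open Matrix
open Literature.MathematicalPhysics.QuantumFieldTheory.Balaban1983to89
open Literature.MathematicalPhysics.QuantumFieldTheory.Balaban1983to89.T4OutputRate (NE5 DecayBound)
open Literature.MathematicalPhysics.QuantumFieldTheory.Balaban1983to89.B5Prop11Plancherel (Tor fine)
open Literature.MathematicalPhysics.QuantumFieldTheory.Balaban1983to89.TreeLengthTorus (TPt TDom torusTreeLen)
open Literature.MathematicalPhysics.QuantumFieldTheory.Balaban1983to89.B13Lemma3Torus (TwoTorusStep)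
open Literature.MathematicalPhysics.QuantumFieldTheory.King1986 (aK exp_decay_mono)
open Literature.MathematicalPhysics.QuantumFieldTheory.King1986.Torus
  (minimiser effLaplacian blockProj blockOf blockOf_over tdistT tdistT_nonneg)
open Summit.QuantumFields.BalabanUV.T4Continuum.Spine.NE5.TwoRunTorusNE5 (torusCarriers reFunctional)
open Summit.QuantumFields.YangMills.BalabanUVNodes.N18KingModel (kingTheta_pos kingTheta_le_one coarse_val)
open Summit.QuantumFields.YangMills.BalabanUVNodes.N18KingModelEndDecay (exists_live_domain)
open Summit.QuantumFields.YangMills.BalabanUVNodes.N18KingModelLineReadouts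
  (sum_tdom_selection selection_reading_local ne5_reFunctional_of_fieldCubePairs abs_kingGraph_sub_le_of_readings)
open Summit.QuantumFields.YangMills.BalabanUVNodes.N18KingModelOneRunReadouts
  (abs_kingGraph_le_of_readings decayBound_reFunctional_of_fieldCubePairs abs_sum_fibre_mul_le sum_fibre_eq_sum
    sum_fibre_eq_sum_filter)

/-! ## The polymer representation of King's model at every fine point, with `NE5` and (0.25) located activities -/

section Capstone
variable {L' : ℕ} [NeZero L']

open Classical in
/-- **THE POLYMER REPRESENTATION OF KING'S MODEL ON THE END'S CARRIERS, ALL FINE POINTS READ, WITH `NE5` AND (0.25).**  For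
odd `L > 1`, `a > 0`, `m² > 0`, `0 ≤ γ ≤ 1` there are `κ > 0`, `A ≥ 0`, `C₅ ≥ 0` — functions of `L, a, m², γ` (and `d = 4`) ONLY —
such that: for every `n ≥ 1`; every family of Bałaban volumes `L·M_k = 2L^{m_k}` (END tori `(ℤ∕(L·M_{j+1}))^4` at scale `j` =
King's unit torus of level `j + 1`); every END data `W j : TwoTorusStep 4 L′ (L·M_{j+1})`; every family of TEST WEIGHTS ON RUN B's
FINE PAIRS `w_j(φ)(x′, y′)`, `x′, y′ ∈ T_{η′}` (`η′ = L^{−n−j−1}`), indexed by the scale and the scale-`j` configuration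
`φ : (W j).Φ`, BLOCK-ℓ¹-NORMALISED: `Σ_{(x′,y′) : B(x′) = p, B(y′) = q} |w_j(φ)(x′, y′)| ≤ 1` for every pair `(p, q)` of unit blocks;
and every window `W′` — there are CONFIGURATION-DEPENDENT ACTIVITIES `K_A, K_B : (X : Σ j, 𝐃_j) → (W X.1).Φ → ℝ` such that
(a) `NE5 (torusCarriers N W) (reFunctional N W K_A) (reFunctional N W K_B) W′ κ (L^{−γ∕2}) C₅`;
(d) `DecayBound (reFunctional N W K_A) W′ A κ` and `DecayBound (reFunctional N W K_B) W′ A κ` — (0.25) at the SAME `κ`;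
(b) RESUMMATION ((0.24) in the model): for every scale `j` and configuration `φ`,
`Σ_{X ∈ 𝐃_j} K_A⟨j, X⟩ φ = Σ_{(x′,y′)} w_j(φ)(x′,y′)·Σ_{z,w} ℋ_{j+1}(x, z)·C^{(j+1)}(z, w)·ℋ_{j+1}(y, w)` with `x = ⌊x′∕L^n⌋`,
`y = ⌊y′∕L^n⌋` the points of `T_η` UNDER `x′, y′` (King p. 664 «x′ ∈ B^n(x)»), and
`Σ_{X ∈ 𝐃_j} K_B⟨j, X⟩ φ = Σ_{(x′,y′)} w_j(φ)(x′,y′)·Σ_{z,w} ℋ_{j+1+n}(x′, z)·C^{(j+1+n)}(z, w)·ℋ_{j+1+n}(y′, w)`;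
(c) LOCALITY: every `K_A⟨j, X⟩ φ`, `K_B⟨j, X⟩ φ` is the `w`-weighted sum of its run's graph over ONE AND THE SAME finite set of
fine lines `(x′, y′)` whose blocks `(B(x′), B(y′))` are cubes of `X`.
Per fine line: p469937 §3 (two-run rate) and 5b §3 (one-run decay) at the readings under `x′, y′` (`coarse_val`,
`blockOf_over`); per block pair: 5b `abs_sum_fibre_mul_le`; per domain: p469937 `ne5_reFunctional_of_fieldCubePairs` and 5b
`decayBound_reFunctional_of_fieldCubePairs` at `κ∕4` on the selected live polymers (`exists_live_domain`); (b): `sum_tdom_selection`,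
`sum_fibre_eq_sum`; (c): `selection_reading_local`, `sum_fibre_eq_sum_filter`.  A = 0 MODEL; every fine line carried exactly once.
[cite: King1986, Prop. 3.9 (3.73) p.665, p.664, (4.42)–(4.43) p.675, Thm 3.3 p.658; Balaban1987RG1, (0.24)-(0.25) p.257, (1.18) p.263, Thm 1 p.259; Balaban1988RG2Cluster, (2.30) p.18; Balaban1985UV3, p.262] -/
theorem kingModel_polymerRep_finePoints (L : ℕ) [NeZero L] (hLp : Odd L ∧ 1 < L) {a m2 : ℝ} (ha : 0 < a) (hm : 0 < m2)
    {γ : ℝ} (hγ0 : 0 ≤ γ) (hγ1 : γ ≤ 1) :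
    ∃ κ A C₅ : ℝ, 0 < κ ∧ 0 ≤ A ∧ 0 ≤ C₅ ∧
      ∀ (n : ℕ) (_hn : 1 ≤ n) (M : ℕ → ℕ) [∀ k, NeZero (M k)] (_hM : ∀ k, ∃ mm : ℕ, L * M k = 2 * L ^ mm)
        (W : (j : ℕ) → TwoTorusStep 4 L' (L * M (j + 1)))
        (w : (j : ℕ) → (W j).Φ →
          Tor (fine (L ^ n * L ^ (j + 1)) (fine L (fun _ : Fin 4 => M (j + 1)))) ×
            Tor (fine (L ^ n * L ^ (j + 1)) (fine L (fun _ : Fin 4 => M (j + 1)))) → ℝ)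
        (_hw : ∀ (j : ℕ) (φ : (W j).Φ) (pq : TPt 4 (L * M (j + 1)) × TPt 4 (L * M (j + 1))),
          ∑ xy ∈ Finset.univ.filter (fun xy :
              Tor (fine (L ^ n * L ^ (j + 1)) (fine L (fun _ : Fin 4 => M (j + 1)))) ×
                Tor (fine (L ^ n * L ^ (j + 1)) (fine L (fun _ : Fin 4 => M (j + 1)))) =>
              (blockOf (L ^ n * L ^ (j + 1)) (fine L (fun _ : Fin 4 => M (j + 1))) xy.1,
                blockOf (L ^ n * L ^ (j + 1)) (fine L (fun _ : Fin 4 => M (j + 1))) xy.2) = pq), |w j φ xy| ≤ 1)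
        (W' : Set (ℕ → ℝ)),
        ∃ KA KB : (X : Σ j : ℕ, TDom 4 (L * M (j + 1))) → (W X.1).Φ → ℝ,
          NE5 (C := torusCarriers (fun j => L * M (j + 1)) W)
              (reFunctional (fun j => L * M (j + 1)) W fun j X φ => ((KA ⟨j, X⟩ φ : ℝ) : ℂ))
              (reFunctional (fun j => L * M (j + 1)) W fun j X φ => ((KB ⟨j, X⟩ φ : ℝ) : ℂ)) W' κ
              ((L : ℝ) ^ (-(γ / 2))) C₅ ∧
          DecayBound (C := torusCarriers (fun j => L * M (j + 1)) W)
              (reFunctional (fun j => L * M (j + 1)) W fun j X φ => ((KA ⟨j, X⟩ φ : ℝ) : ℂ)) W' A κ ∧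
          DecayBound (C := torusCarriers (fun j => L * M (j + 1)) W)
              (reFunctional (fun j => L * M (j + 1)) W fun j X φ => ((KB ⟨j, X⟩ φ : ℝ) : ℂ)) W' A κ ∧
          (∀ (j : ℕ) (φ : (W j).Φ), ∑ X : TDom 4 (L * M (j + 1)), KA ⟨j, X⟩ φ =
            ∑ xy : Tor (fine (L ^ n * L ^ (j + 1)) (fine L (fun _ : Fin 4 => M (j + 1)))) ×
                Tor (fine (L ^ n * L ^ (j + 1)) (fine L (fun _ : Fin 4 => M (j + 1)))), w j φ xy *
              ((fun z => minimiser (L ^ (j + 1)) (fine L (fun _ : Fin 4 => M (j + 1))) (aK a L (j + 1))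
                    (((L ^ (j + 1) : ℕ) : ℝ) ^ 2) m2 (Pi.single z 1)
                    (fun μ => (((xy.1 μ).val / L ^ n : ℕ) :
                      ZMod (fine (L ^ (j + 1)) (fine L (fun _ : Fin 4 => M (j + 1))) μ))))
                ⬝ᵥ ((effLaplacian (L ^ (j + 1)) (fine L (fun _ : Fin 4 => M (j + 1))) (aK a L (j + 1))
                        (((L ^ (j + 1) : ℕ) : ℝ) ^ 2) m2
                      + (a * ((L : ℝ) ^ 2)⁻¹) • blockProj L (fun _ : Fin 4 => M (j + 1)))⁻¹
                    *ᵥ fun w' => minimiser (L ^ (j + 1)) (fine L (fun _ : Fin 4 => M (j + 1))) (aK a L (j + 1))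
                        (((L ^ (j + 1) : ℕ) : ℝ) ^ 2) m2 (Pi.single w' 1)
                        (fun μ => (((xy.2 μ).val / L ^ n : ℕ) :
                          ZMod (fine (L ^ (j + 1)) (fine L (fun _ : Fin 4 => M (j + 1))) μ)))))) ∧
          (∀ (j : ℕ) (φ : (W j).Φ), ∑ X : TDom 4 (L * M (j + 1)), KB ⟨j, X⟩ φ =
            ∑ xy : Tor (fine (L ^ n * L ^ (j + 1)) (fine L (fun _ : Fin 4 => M (j + 1)))) ×
                Tor (fine (L ^ n * L ^ (j + 1)) (fine L (fun _ : Fin 4 => M (j + 1)))), w j φ xy *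
              ((fun z => minimiser (L ^ n * L ^ (j + 1)) (fine L (fun _ : Fin 4 => M (j + 1))) (aK a L (j + 1 + n))
                    (((L ^ n * L ^ (j + 1) : ℕ) : ℝ) ^ 2) m2 (Pi.single z 1) xy.1)
                ⬝ᵥ ((effLaplacian (L ^ n * L ^ (j + 1)) (fine L (fun _ : Fin 4 => M (j + 1))) (aK a L (j + 1 + n))
                        (((L ^ n * L ^ (j + 1) : ℕ) : ℝ) ^ 2) m2
                      + (a * ((L : ℝ) ^ 2)⁻¹) • blockProj L (fun _ : Fin 4 => M (j + 1)))⁻¹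
                    *ᵥ fun w' => minimiser (L ^ n * L ^ (j + 1)) (fine L (fun _ : Fin 4 => M (j + 1)))
                        (aK a L (j + 1 + n)) (((L ^ n * L ^ (j + 1) : ℕ) : ℝ) ^ 2) m2 (Pi.single w' 1) xy.2))) ∧
          (∀ (j : ℕ) (X : TDom 4 (L * M (j + 1))) (φ : (W j).Φ),
            ∃ S : Finset (Tor (fine (L ^ n * L ^ (j + 1)) (fine L (fun _ : Fin 4 => M (j + 1)))) ×
                Tor (fine (L ^ n * L ^ (j + 1)) (fine L (fun _ : Fin 4 => M (j + 1))))),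
            (∀ xy ∈ S, (blockOf (L ^ n * L ^ (j + 1)) (fine L (fun _ : Fin 4 => M (j + 1))) xy.1,
                blockOf (L ^ n * L ^ (j + 1)) (fine L (fun _ : Fin 4 => M (j + 1))) xy.2) ∈ X.1 ×ˢ X.1) ∧
            KA ⟨j, X⟩ φ = ∑ xy ∈ S, w j φ xy *
              ((fun z => minimiser (L ^ (j + 1)) (fine L (fun _ : Fin 4 => M (j + 1))) (aK a L (j + 1))
                    (((L ^ (j + 1) : ℕ) : ℝ) ^ 2) m2 (Pi.single z 1)
                    (fun μ => (((xy.1 μ).val / L ^ n : ℕ) :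
                      ZMod (fine (L ^ (j + 1)) (fine L (fun _ : Fin 4 => M (j + 1))) μ))))
                ⬝ᵥ ((effLaplacian (L ^ (j + 1)) (fine L (fun _ : Fin 4 => M (j + 1))) (aK a L (j + 1))
                        (((L ^ (j + 1) : ℕ) : ℝ) ^ 2) m2
                      + (a * ((L : ℝ) ^ 2)⁻¹) • blockProj L (fun _ : Fin 4 => M (j + 1)))⁻¹
                    *ᵥ fun w' => minimiser (L ^ (j + 1)) (fine L (fun _ : Fin 4 => M (j + 1))) (aK a L (j + 1))
                        (((L ^ (j + 1) : ℕ) : ℝ) ^ 2) m2 (Pi.single w' 1)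
                        (fun μ => (((xy.2 μ).val / L ^ n : ℕ) :
                          ZMod (fine (L ^ (j + 1)) (fine L (fun _ : Fin 4 => M (j + 1))) μ))))) ∧
            KB ⟨j, X⟩ φ = ∑ xy ∈ S, w j φ xy *
              ((fun z => minimiser (L ^ n * L ^ (j + 1)) (fine L (fun _ : Fin 4 => M (j + 1))) (aK a L (j + 1 + n))
                    (((L ^ n * L ^ (j + 1) : ℕ) : ℝ) ^ 2) m2 (Pi.single z 1) xy.1)
                ⬝ᵥ ((effLaplacian (L ^ n * L ^ (j + 1)) (fine L (fun _ : Fin 4 => M (j + 1))) (aK a L (j + 1 + n))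
                        (((L ^ n * L ^ (j + 1) : ℕ) : ℝ) ^ 2) m2
                      + (a * ((L : ℝ) ^ 2)⁻¹) • blockProj L (fun _ : Fin 4 => M (j + 1)))⁻¹
                    *ᵥ fun w' => minimiser (L ^ n * L ^ (j + 1)) (fine L (fun _ : Fin 4 => M (j + 1)))
                        (aK a L (j + 1 + n)) (((L ^ n * L ^ (j + 1) : ℕ) : ℝ) ^ 2) m2 (Pi.single w' 1) xy.2))) := by
  obtain ⟨κ₂, C₅, hκ₂, hC₅, H₂⟩ := abs_kingGraph_sub_le_of_readings (d := 4) (by norm_num) L hLp ha hm hγ0 hγ1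
  obtain ⟨κ₁, A, hκ₁, hA, H₁⟩ := abs_kingGraph_le_of_readings (d := 4) (by norm_num) L hLp ha hm
  set κ : ℝ := min κ₁ κ₂ with hκ_def
  have hκ : 0 < κ := lt_min hκ₁ hκ₂
  refine ⟨κ / 4 / 2, A * (4 * 2 ^ 4) ^ 2 * (((2 : ℕ).factorial : ℝ) * (2 / (κ / 4)) ^ 2 * Real.exp (κ / 4 / 2)),
    C₅ * (4 * 2 ^ 4) ^ 2 * (((2 : ℕ).factorial : ℝ) * (2 / (κ / 4)) ^ 2 * Real.exp (κ / 4 / 2)),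
    by positivity, by positivity, by positivity, ?_⟩
  intro n hn M _ hM W w hw W'
  set θ : ℝ := (L : ℝ) ^ (-(γ / 2)) with hθ_def
  have hL1 : 1 ≤ L := by have := hLp.2; omega
  have hLn : 0 < L ^ n := pow_pos (Nat.pos_of_ne_zero (NeZero.ne L)) n
  have hθ0 : 0 ≤ θ := (kingTheta_pos hL1 (γ / 2)).le
  have hθ1 : θ ≤ 1 := kingTheta_le_one hL1 (by linarith)
  -- the run-A point UNDER a run-B fine point (King p. 664 «x′ ∈ B^n(x)»)
  let cA : (j : ℕ) → Tor (fine (L ^ n * L ^ (j + 1)) (fine L (fun _ : Fin 4 => M (j + 1)))) →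
      Tor (fine (L ^ (j + 1)) (fine L (fun _ : Fin 4 => M (j + 1)))) :=
    fun j x' μ => (((x' μ).val / L ^ n : ℕ) : ZMod (fine (L ^ (j + 1)) (fine L (fun _ : Fin 4 => M (j + 1))) μ))
  have hcA : ∀ (j : ℕ) (x' : Tor (fine (L ^ n * L ^ (j + 1)) (fine L (fun _ : Fin 4 => M (j + 1))))) (μ : Fin 4),
      (cA j x' μ).val = (x' μ).val / L ^ n := fun j x' μ => coarse_val hLn x' μ
  -- the two runs' (4.42) graphs on a fine line, run A at the points under it
  let GA : (j : ℕ) → Tor (fine (L ^ n * L ^ (j + 1)) (fine L (fun _ : Fin 4 => M (j + 1)))) ×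
      Tor (fine (L ^ n * L ^ (j + 1)) (fine L (fun _ : Fin 4 => M (j + 1)))) → ℝ := fun j xy =>
    (fun z => minimiser (L ^ (j + 1)) (fine L (fun _ : Fin 4 => M (j + 1))) (aK a L (j + 1))
          (((L ^ (j + 1) : ℕ) : ℝ) ^ 2) m2 (Pi.single z 1) (cA j xy.1))
      ⬝ᵥ ((effLaplacian (L ^ (j + 1)) (fine L (fun _ : Fin 4 => M (j + 1))) (aK a L (j + 1))
              (((L ^ (j + 1) : ℕ) : ℝ) ^ 2) m2
            + (a * ((L : ℝ) ^ 2)⁻¹) • blockProj L (fun _ : Fin 4 => M (j + 1)))⁻¹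
          *ᵥ fun w' => minimiser (L ^ (j + 1)) (fine L (fun _ : Fin 4 => M (j + 1))) (aK a L (j + 1))
              (((L ^ (j + 1) : ℕ) : ℝ) ^ 2) m2 (Pi.single w' 1) (cA j xy.2))
  let GB : (j : ℕ) → Tor (fine (L ^ n * L ^ (j + 1)) (fine L (fun _ : Fin 4 => M (j + 1)))) ×
      Tor (fine (L ^ n * L ^ (j + 1)) (fine L (fun _ : Fin 4 => M (j + 1)))) → ℝ := fun j xy =>
    (fun z => minimiser (L ^ n * L ^ (j + 1)) (fine L (fun _ : Fin 4 => M (j + 1))) (aK a L (j + 1 + n))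
          (((L ^ n * L ^ (j + 1) : ℕ) : ℝ) ^ 2) m2 (Pi.single z 1) xy.1)
      ⬝ᵥ ((effLaplacian (L ^ n * L ^ (j + 1)) (fine L (fun _ : Fin 4 => M (j + 1))) (aK a L (j + 1 + n))
              (((L ^ n * L ^ (j + 1) : ℕ) : ℝ) ^ 2) m2
            + (a * ((L : ℝ) ^ 2)⁻¹) • blockProj L (fun _ : Fin 4 => M (j + 1)))⁻¹
          *ᵥ fun w' => minimiser (L ^ n * L ^ (j + 1)) (fine L (fun _ : Fin 4 => M (j + 1)))
              (aK a L (j + 1 + n)) (((L ^ n * L ^ (j + 1) : ℕ) : ℝ) ^ 2) m2 (Pi.single w' 1) xy.2)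
  -- the block pair of a fine line
  let blk : (j : ℕ) → Tor (fine (L ^ n * L ^ (j + 1)) (fine L (fun _ : Fin 4 => M (j + 1)))) ×
      Tor (fine (L ^ n * L ^ (j + 1)) (fine L (fun _ : Fin 4 => M (j + 1)))) →
      TPt 4 (L * M (j + 1)) × TPt 4 (L * M (j + 1)) := fun j xy =>
    (blockOf (L ^ n * L ^ (j + 1)) (fine L (fun _ : Fin 4 => M (j + 1))) xy.1,
      blockOf (L ^ n * L ^ (j + 1)) (fine L (fun _ : Fin 4 => M (j + 1))) xy.2)
  -- King's (3.73) per fine line: the two-run rate (p469937 §3) and the one-run decay (5b §3), at the common rate `κ`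
  have hM' : ∀ k, ∃ mm : ℕ, ∀ _μ : Fin 4, L * M k = 2 * L ^ mm := fun k => (hM k).imp fun _ h _ => h
  have hline2 : ∀ (j : ℕ) (xy : Tor (fine (L ^ n * L ^ (j + 1)) (fine L (fun _ : Fin 4 => M (j + 1)))) ×
      Tor (fine (L ^ n * L ^ (j + 1)) (fine L (fun _ : Fin 4 => M (j + 1))))),
      |GA j xy - GB j xy| ≤ C₅ * θ ^ (j + 1) *
        Real.exp (-(κ * tdistT (fine L (fun _ : Fin 4 => M (j + 1))) (blk j xy).1 (blk j xy).2)) := by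
    intro j xy
    have h := H₂ n hn (fun k (_ : Fin 4) => M k) hM'
      (Σ j : ℕ, Tor (fine (L ^ n * L ^ (j + 1)) (fine L (fun _ : Fin 4 => M (j + 1)))) ×
        Tor (fine (L ^ n * L ^ (j + 1)) (fine L (fun _ : Fin 4 => M (j + 1)))))
      (fun l => l.1 + 1) (fun _ => Nat.succ_pos _)
      (fun l => cA l.1 l.2.1) (fun l => cA l.1 l.2.2) (fun l => l.2.1) (fun l => l.2.2)
      (fun l μ => hcA l.1 l.2.1 μ) (fun l μ => hcA l.1 l.2.2 μ) ⟨j, xy⟩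
    have e1 := blockOf_over (fine L (fun _ : Fin 4 => M (j + 1))) (cA j xy.1) xy.1 (hcA j xy.1)
    have e2 := blockOf_over (fine L (fun _ : Fin 4 => M (j + 1))) (cA j xy.2) xy.2 (hcA j xy.2)
    calc |GA j xy - GB j xy|
        ≤ C₅ * ((L : ℝ) ^ (-(γ / 2))) ^ (j + 1) * Real.exp (-(κ₂ * tdistT (fine L (fun _ : Fin 4 => M (j + 1)))
            (blockOf (L ^ (j + 1)) (fine L (fun _ : Fin 4 => M (j + 1))) (cA j xy.1))
            (blockOf (L ^ (j + 1)) (fine L (fun _ : Fin 4 => M (j + 1))) (cA j xy.2)))) := h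
      _ = C₅ * θ ^ (j + 1) * Real.exp (-(κ₂ * tdistT (fine L (fun _ : Fin 4 => M (j + 1)))
            (blk j xy).1 (blk j xy).2)) := by rw [← e1, ← e2]
      _ ≤ C₅ * θ ^ (j + 1) * Real.exp (-(κ * tdistT (fine L (fun _ : Fin 4 => M (j + 1)))
            (blk j xy).1 (blk j xy).2)) :=
          exp_decay_mono (mul_nonneg hC₅ (pow_nonneg hθ0 _)) (min_le_right _ _) (tdistT_nonneg _ _ _)
  have hline1 : ∀ (j : ℕ) (xy : Tor (fine (L ^ n * L ^ (j + 1)) (fine L (fun _ : Fin 4 => M (j + 1)))) ×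
      Tor (fine (L ^ n * L ^ (j + 1)) (fine L (fun _ : Fin 4 => M (j + 1))))),
      |GA j xy| ≤ A * Real.exp (-(κ * tdistT (fine L (fun _ : Fin 4 => M (j + 1))) (blk j xy).1 (blk j xy).2)) ∧
      |GB j xy| ≤ A * Real.exp (-(κ * tdistT (fine L (fun _ : Fin 4 => M (j + 1))) (blk j xy).1 (blk j xy).2)) := by
    intro j xy
    have h := H₁ n hn (fun k (_ : Fin 4) => M k) hM'
      (Σ j : ℕ, Tor (fine (L ^ n * L ^ (j + 1)) (fine L (fun _ : Fin 4 => M (j + 1)))) ×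
        Tor (fine (L ^ n * L ^ (j + 1)) (fine L (fun _ : Fin 4 => M (j + 1)))))
      (fun l => l.1 + 1) (fun _ => Nat.succ_pos _)
      (fun l => cA l.1 l.2.1) (fun l => cA l.1 l.2.2) (fun l => l.2.1) (fun l => l.2.2)
      (fun l μ => hcA l.1 l.2.1 μ) (fun l μ => hcA l.1 l.2.2 μ) ⟨j, xy⟩
    have e1 := blockOf_over (fine L (fun _ : Fin 4 => M (j + 1))) (cA j xy.1) xy.1 (hcA j xy.1)
    have e2 := blockOf_over (fine L (fun _ : Fin 4 => M (j + 1))) (cA j xy.2) xy.2 (hcA j xy.2)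
    constructor
    · calc |GA j xy|
          ≤ A * Real.exp (-(κ₁ * tdistT (fine L (fun _ : Fin 4 => M (j + 1)))
              (blockOf (L ^ (j + 1)) (fine L (fun _ : Fin 4 => M (j + 1))) (cA j xy.1))
              (blockOf (L ^ (j + 1)) (fine L (fun _ : Fin 4 => M (j + 1))) (cA j xy.2)))) := h.1
        _ = A * Real.exp (-(κ₁ * tdistT (fine L (fun _ : Fin 4 => M (j + 1))) (blk j xy).1 (blk j xy).2)) := by
            rw [← e1, ← e2]
        _ ≤ A * Real.exp (-(κ * tdistT (fine L (fun _ : Fin 4 => M (j + 1))) (blk j xy).1 (blk j xy).2)) :=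
            exp_decay_mono hA (min_le_left _ _) (tdistT_nonneg _ _ _)
    · calc |GB j xy|
          ≤ A * Real.exp (-(κ₁ * tdistT (fine L (fun _ : Fin 4 => M (j + 1)))
              (blockOf (L ^ (j + 1)) (fine L (fun _ : Fin 4 => M (j + 1))) (cA j xy.1))
              (blockOf (L ^ (j + 1)) (fine L (fun _ : Fin 4 => M (j + 1))) (cA j xy.2)))) := h.2
        _ = A * Real.exp (-(κ₁ * tdistT (fine L (fun _ : Fin 4 => M (j + 1))) (blk j xy).1 (blk j xy).2)) := by
            rw [← e1, ← e2]
        _ ≤ A * Real.exp (-(κ * tdistT (fine L (fun _ : Fin 4 => M (j + 1))) (blk j xy).1 (blk j xy).2)) :=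
            exp_decay_mono hA (min_le_left _ _) (tdistT_nonneg _ _ _)
  -- a connecting polymer for every pair of blocks at every scale (module 1 §3)
  choose Xs hXs using fun (j : ℕ) (pq : TPt 4 (L * M (j + 1)) × TPt 4 (L * M (j + 1))) =>
    exists_live_domain L (M (j + 1)) pq.1 pq.2
  -- located at the selected connecting polymer of the block pair: `θ^{j+1} ≤ θ^j`, `e^{−κ|p−q|} ≤ e^{−(κ/4)d_j(X)}`
  have hexpX : ∀ (j : ℕ) (pq : TPt 4 (L * M (j + 1)) × TPt 4 (L * M (j + 1))),
      Real.exp (-(κ * tdistT (fine L (fun _ : Fin 4 => M (j + 1))) pq.1 pq.2))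
        ≤ Real.exp (-(κ / 4 * torusTreeLen (Xs j pq).1)) := by
    intro j pq
    refine Real.exp_le_exp.2 ?_
    have := (hXs j pq).2.2
    have : κ * (1 / 4 * torusTreeLen (Xs j pq).1) ≤
        κ * tdistT (fine L (fun _ : Fin 4 => M (j + 1))) pq.1 pq.2 := mul_le_mul_of_nonneg_left this hκ.le
    linarith
  have hloc2 : ∀ (j : ℕ) (pq : TPt 4 (L * M (j + 1)) × TPt 4 (L * M (j + 1))) xy, blk j xy = pq →
      |GA j xy - GB j xy| ≤ C₅ * θ ^ j * Real.exp (-(κ / 4 * torusTreeLen (Xs j pq).1)) := by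
    intro j pq xy hxy
    refine (hline2 j xy).trans ?_
    rw [hxy]
    refine mul_le_mul (mul_le_mul_of_nonneg_left ?_ hC₅) (hexpX j pq) (Real.exp_pos _).le
      (mul_nonneg hC₅ (pow_nonneg hθ0 _))
    calc θ ^ (j + 1) = θ ^ j * θ := pow_succ θ j
      _ ≤ θ ^ j * 1 := mul_le_mul_of_nonneg_left hθ1 (pow_nonneg hθ0 _)
      _ = θ ^ j := mul_one _
  have hloc1 : ∀ (j : ℕ) (pq : TPt 4 (L * M (j + 1)) × TPt 4 (L * M (j + 1))) xy, blk j xy = pq →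
      |GA j xy| ≤ A * Real.exp (-(κ / 4 * torusTreeLen (Xs j pq).1)) ∧
      |GB j xy| ≤ A * Real.exp (-(κ / 4 * torusTreeLen (Xs j pq).1)) := by
    intro j pq xy hxy
    obtain ⟨h1, h2⟩ := hline1 j xy
    rw [hxy] at h1 h2
    exact ⟨h1.trans (mul_le_mul_of_nonneg_left (hexpX j pq) hA), h2.trans (mul_le_mul_of_nonneg_left (hexpX j pq) hA)⟩
  -- the fibre sums: a block pair's fine lines, weighted (block-ℓ¹-normalised)
  let gA : (j : ℕ) → (W j).Φ → TPt 4 (L * M (j + 1)) × TPt 4 (L * M (j + 1)) → ℝ := fun j φ pq =>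
    ∑ xy ∈ Finset.univ.filter (fun xy :
        Tor (fine (L ^ n * L ^ (j + 1)) (fine L (fun _ : Fin 4 => M (j + 1)))) ×
          Tor (fine (L ^ n * L ^ (j + 1)) (fine L (fun _ : Fin 4 => M (j + 1)))) =>
        (blockOf (L ^ n * L ^ (j + 1)) (fine L (fun _ : Fin 4 => M (j + 1))) xy.1,
          blockOf (L ^ n * L ^ (j + 1)) (fine L (fun _ : Fin 4 => M (j + 1))) xy.2) = pq), w j φ xy * GA j xy
  let gB : (j : ℕ) → (W j).Φ → TPt 4 (L * M (j + 1)) × TPt 4 (L * M (j + 1)) → ℝ := fun j φ pq =>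
    ∑ xy ∈ Finset.univ.filter (fun xy :
        Tor (fine (L ^ n * L ^ (j + 1)) (fine L (fun _ : Fin 4 => M (j + 1)))) ×
          Tor (fine (L ^ n * L ^ (j + 1)) (fine L (fun _ : Fin 4 => M (j + 1)))) =>
        (blockOf (L ^ n * L ^ (j + 1)) (fine L (fun _ : Fin 4 => M (j + 1))) xy.1,
          blockOf (L ^ n * L ^ (j + 1)) (fine L (fun _ : Fin 4 => M (j + 1))) xy.2) = pq), w j φ xy * GB j xy
  have hgAB : ∀ (j : ℕ) (φ : (W j).Φ) (pq : TPt 4 (L * M (j + 1)) × TPt 4 (L * M (j + 1))),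
      |gA j φ pq - gB j φ pq| ≤ C₅ * θ ^ j * Real.exp (-(κ / 4 * torusTreeLen (Xs j pq).1)) := by
    intro j φ pq
    have hsub : gA j φ pq - gB j φ pq = ∑ xy ∈ Finset.univ.filter (fun xy :
        Tor (fine (L ^ n * L ^ (j + 1)) (fine L (fun _ : Fin 4 => M (j + 1)))) ×
          Tor (fine (L ^ n * L ^ (j + 1)) (fine L (fun _ : Fin 4 => M (j + 1)))) =>
        (blockOf (L ^ n * L ^ (j + 1)) (fine L (fun _ : Fin 4 => M (j + 1))) xy.1,
          blockOf (L ^ n * L ^ (j + 1)) (fine L (fun _ : Fin 4 => M (j + 1))) xy.2) = pq),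
        w j φ xy * (GA j xy - GB j xy) := by
      show (∑ xy ∈ _, w j φ xy * GA j xy) - (∑ xy ∈ _, w j φ xy * GB j xy) = _
      rw [← Finset.sum_sub_distrib]
      exact Finset.sum_congr rfl fun xy _ => (mul_sub _ _ _).symm
    rw [hsub]
    exact abs_sum_fibre_mul_le (blk j) pq (by positivity) (hw j φ pq) (fun xy hxy => hloc2 j pq xy hxy)
  have hgA : ∀ (j : ℕ) (φ : (W j).Φ) (pq : TPt 4 (L * M (j + 1)) × TPt 4 (L * M (j + 1))),
      |gA j φ pq| ≤ A * Real.exp (-(κ / 4 * torusTreeLen (Xs j pq).1)) := fun j φ pq =>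
    abs_sum_fibre_mul_le (blk j) pq (by positivity) (hw j φ pq) (fun xy hxy => (hloc1 j pq xy hxy).1)
  have hgB : ∀ (j : ℕ) (φ : (W j).Φ) (pq : TPt 4 (L * M (j + 1)) × TPt 4 (L * M (j + 1))),
      |gB j φ pq| ≤ A * Real.exp (-(κ / 4 * torusTreeLen (Xs j pq).1)) := fun j φ pq =>
    abs_sum_fibre_mul_le (blk j) pq (by positivity) (hw j φ pq) (fun xy hxy => (hloc1 j pq xy hxy).2)
  -- the activities: at `⟨j, X⟩`, the fibre sums of the block pairs of `X` whose selected polymer is `X`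
  refine ⟨fun X φ => ∑ pq ∈ X.2.1 ×ˢ X.2.1, (if Xs X.1 pq = X.2 then gA X.1 φ pq else 0),
    fun X φ => ∑ pq ∈ X.2.1 ×ˢ X.2.1, (if Xs X.1 pq = X.2 then gB X.1 φ pq else 0), ?_, ?_, ?_, ?_, ?_, ?_⟩
  · -- (a) NE5: p469937 §2 with `κ/4`
    exact ne5_reFunctional_of_fieldCubePairs (fun j => L * M (j + 1)) W
      (fun X φ => ∑ pq ∈ X.2.1 ×ˢ X.2.1, (if Xs X.1 pq = X.2 then gA X.1 φ pq else 0))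
      (fun X φ => ∑ pq ∈ X.2.1 ×ˢ X.2.1, (if Xs X.1 pq = X.2 then gB X.1 φ pq else 0))
      (fun X φ pq => if Xs X.1 pq = X.2 then gA X.1 φ pq else 0)
      (fun X φ pq => if Xs X.1 pq = X.2 then gB X.1 φ pq else 0)
      (κ := κ / 4) (by positivity) hθ0 hC₅ (fun X φ => by rw [← Finset.sum_sub_distrib]) (fun X φ pq _ => by
        by_cases hsel : Xs X.1 pq = X.2
        · rw [if_pos hsel, if_pos hsel]
          have h1 := hgAB X.1 φ pq
          rw [hsel] at h1
          exact h1
        · rw [if_neg hsel, if_neg hsel, sub_self, abs_zero]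
          positivity) W'
  · -- (d) (0.25), run A: 5b §4 with `κ/4`
    exact decayBound_reFunctional_of_fieldCubePairs (fun j => L * M (j + 1)) W
      (fun X φ => ∑ pq ∈ X.2.1 ×ˢ X.2.1, (if Xs X.1 pq = X.2 then gA X.1 φ pq else 0))
      (fun X φ pq => if Xs X.1 pq = X.2 then gA X.1 φ pq else 0)
      (κ := κ / 4) (by positivity) hA (fun X φ => rfl) (fun X φ pq _ => by
        by_cases hsel : Xs X.1 pq = X.2
        · rw [if_pos hsel]
          have h1 := hgA X.1 φ pq
          rw [hsel] at h1
          exact h1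
        · rw [if_neg hsel, abs_zero]
          positivity) W'
  · -- (d) (0.25), run B
    exact decayBound_reFunctional_of_fieldCubePairs (fun j => L * M (j + 1)) W
      (fun X φ => ∑ pq ∈ X.2.1 ×ˢ X.2.1, (if Xs X.1 pq = X.2 then gB X.1 φ pq else 0))
      (fun X φ pq => if Xs X.1 pq = X.2 then gB X.1 φ pq else 0)
      (κ := κ / 4) (by positivity) hA (fun X φ => rfl) (fun X φ pq _ => by
        by_cases hsel : Xs X.1 pq = X.2
        · rw [if_pos hsel]
          have h1 := hgB X.1 φ pq
          rw [hsel] at h1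
          exact h1
        · rw [if_neg hsel, abs_zero]
          positivity) W'
  · -- (b) resummation, run A: every block pair once (p469937 §1), every fine line of a block pair once (5b §5)
    intro j φ
    rw [sum_tdom_selection (Xs j) (fun pq => Finset.mem_product.2 ⟨(hXs j pq).1, (hXs j pq).2.1⟩) (fun pq => gA j φ pq)]
    exact sum_fibre_eq_sum (blk j) (fun xy => w j φ xy * GA j xy)
  · -- (b) resummation, run B
    intro j φ
    rw [sum_tdom_selection (Xs j) (fun pq => Finset.mem_product.2 ⟨(hXs j pq).1, (hXs j pq).2.1⟩) (fun pq => gB j φ pq)]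
    exact sum_fibre_eq_sum (blk j) (fun xy => w j φ xy * GB j xy)
  · -- (c) locality: the fine lines whose block pair is a pair of cubes of `X` selecting `X`, the same in both runs
    intro j X φ
    refine ⟨Finset.univ.filter (fun xy => blk j xy ∈ (X.1 ×ˢ X.1).filter (fun pq => Xs j pq = X)),
      fun xy hxy => (Finset.mem_filter.1 (Finset.mem_filter.1 hxy).2).1, ?_, ?_⟩
    · show ∑ pq ∈ X.1 ×ˢ X.1, (if Xs j pq = X then gA j φ pq else 0) = _
      rw [selection_reading_local (Xs j) X (fun pq => gA j φ pq)]
      exact sum_fibre_eq_sum_filter (blk j) _ (fun xy => w j φ xy * GA j xy)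
    · show ∑ pq ∈ X.1 ×ˢ X.1, (if Xs j pq = X then gB j φ pq else 0) = _
      rw [selection_reading_local (Xs j) X (fun pq => gB j φ pq)]
      exact sum_fibre_eq_sum_filter (blk j) _ (fun xy => w j φ xy * GB j xy)

end Capstone

end Summit.QuantumFields.YangMills.BalabanUVNodes.N18KingModelFinePoints

end
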